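import Summits.BirchSwinnertonDyer.BirchSwinnertonDyer.Theorems.ClassRecordThreeEulerHalvesAtThreeResidualUpperBoundCartanEmptyDegreeIndepOfEichler
import Literature.NumberTheory.Automorphic.ShimuraCurveIdealsPrincipal
import HarnessLib

/-!
# Crux 23422 `EulerHalvesAtThreeResidualUpperBound`, line `cartan`: STUB (F2⁰) `stub_cartanEmptyDegreeIndep` — CLOSED

Seat `bsd-stepL-cartan-f20` (AUTOFILL #2 row (2); `--supports stmt-BirchSwinnertonDyer-23422`, registered stub
`stub_cartanEmptyDegreeIndep : CartanDegree.CartanEmptyDegreeIndep` of `Cruxes/EulerHalvesAtThreeResidualUpperBound/Lines/cartan.lean`).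
UNCONDITIONAL: the hypothesis `hE` of `CartanDegree.cartanEmptyDegreeIndep_of_eichler` (file `…CartanEmptyDegreeIndepOfEichler`)
is discharged by the tree theorem `ShimuraCurveData.exists_eq_units_smul_of_pos` (Eichler's principal-ideal theorem for the
Eichler order of `X₀^D(M)`, `D > 1`; `Literature/NumberTheory/Automorphic/ShimuraCurveIdealsPrincipal.lean`, Vignéras III §5
Cor. 5.7). Presentation-independence of the class-minimal degree at level `(D, M; ∅)`: Hasse–Brauer–Noether (algebras),
Eichler (type number one, units of norm `-1`), Skolem–Noether (real splittings), transport of parametrisation data along `τ ↦ g τ`.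
HONEST FRAMING: closes the stub (F2⁰) only; the crux 23422 keeps its other stubs; nothing about `Ш`; BSD is proved for no curve.
[cite: VignerasLNM800, Ch. III §5 Cor. 5.7, Ch. III §3 Thm. 3.1, Ch. I §2 Thm. 2.1]
-/

set_option linter.dupNamespace false
set_option autoImplicit false

namespace Summit.BirchSwinnertonDyer.BirchSwinnertonDyer.Theorems.CartanDegree

open Literature.NumberTheory.Automorphic

/-- **STUB (F2⁰) `stub_cartanEmptyDegreeIndep` — presentation-independence of the class-minimal degree at level `(D, M; ∅)`**,
unconditionally: `cartanEmptyDegreeIndep_of_eichler` with Eichler's principal-ideal theorem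
`ShimuraCurveData.exists_eq_units_smul_of_pos` plugged in. [cite: VignerasLNM800, Ch. III §5 Cor. 5.7 and Ch. I §2 Thm. 2.1] -/
theorem stub_cartanEmptyDegreeIndep : CartanDegree.CartanEmptyDegreeIndep :=
  cartanEmptyDegreeIndep_of_eichler fun X hD hM _ hI hIO => X.exists_eq_units_smul_of_pos hD hM hI hIO

end Summit.BirchSwinnertonDyer.BirchSwinnertonDyer.Theorems.CartanDegree
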